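import Literature.MathematicalPhysics.QuantumFieldTheory.Balaban1983to89.B8Prop6DentedCubeMemberGaugedRealGammaRec
import Literature.MathematicalPhysics.QuantumFieldTheory.Balaban1983to89.B8Prop6DentedCubeMemberFlatScalarGammaGRec

/-!
# `Balaban1983to89.B8Prop6DentedCubeMemberGaugedRealGammaGRec` — RECORD TWIN of `B8Prop6CubeMemberGaugedRealGammaG` AT THE DENTED MEMBER ([Balaban1985RegularSpaces]
# PROPOSITION 6 (1.135)–(1.138) p. 99 ∕ [Balaban1985Variational] (152)–(153) at every dented record cube of print's p. 98 sub-lattice, edition γ, WITH A `G`-VALUED GAUGE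
# TRANSFORMATION — joint J-SU, [Balaban1985Averaging] p. 20 «We consider a Lie subgroup G of a unitary group U(N)», print's case of record `G = SU(N)`) FOR THE SYMMETRISED
# CENTRED block averaging (0.4) of [Balaban1987RG1]

statement-level skeleton of published theorems with citation tags; proofs where landed; nothing here is a claim about the Yang–Mills mass gap

T. Bałaban, *Spaces of regular gauge field configurations on a lattice and gauge fixing conditions*, Commun. Math. Phys. **99** (1985) 75–102 `[Balaban1985RegularSpaces]`
("[6]"): Prop. 6 (1.135)–(1.138) p. 99, p. 98, (1.134) p. 99, (1.137) p. 99, Thm 4 p. 88, Prop. 3 p. 87, Prop. 5 pp. 93–94, (1.58)–(1.62) pp. 86–87, (1.31) p. 82;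
T. Bałaban, *The variational problem and background fields in renormalization group method for lattice gauge theories*, Commun. Math. Phys. **102** (1985) 277–309
`[Balaban1985Variational]` ("[15]"): (148)–(153) p. 301; T. Bałaban, *Averaging operations for lattice gauge theories*, Commun. Math. Phys. **98** (1985) 17–51
`[Balaban1985Averaging]` ("[3]"): p. 20, Prop. 4 p. 38; T. Bałaban, *Propagators for lattice gauge theories in a background field*, Commun. Math. Phys. **99** (1985) 389–434
`[Balaban1985BackgroundPropagators]` ("[4]"): Thms 3.1–3.3 pp. 397–399; T. Bałaban, *Renormalization group approach to lattice gauge field theories. I*, Commun. Math. Phys.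
**109** (1987) 249–301 `[Balaban1987RG1]` ("[I]"): (0.3)–(0.4) pp. 252–253.  STATUS: published, refereed.

CITATION HEADER (lean-in-tree rule).  Cell `pub-ymgap`, «N05-REC» R8 = the `G`∕τ-EDITION OF RECORD (desk `R6-PLAN.md` §6 (B)), file G5 — LEAD PEN dag-n05-e g40.  WHAT IS
REPRODUCED = §1 ★ `gaugedBoundB8DZBody_of_clauses_mem` — ✓`B8Prop6DentedCubeMemberGaugedRec.gaugedBoundB8D_of_clauses` with `u`, `v⁻¹u` `G`-valued and the conclusion =
`GaugedBoundB8DZ`'s ∃-body with the two memberships at `G`; §2 ★★ `gaugedBoundB8D_dentedMember_real_γ_mem` — ✓`B8Prop6DentedCubeMemberGaugedRealGammaRec.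
gaugedBoundB8D_dentedMember_real_γ` VERBATIM with the joint J-SU data threaded exactly as the engine's `B8Prop6CubeMemberGaugedRealGammaG` threads them (this seat g33):
served by (G4) `B8Prop6DentedCubeMemberFlatScalarGammaGRec.prop6_dentedMember_flat_of_real_γ_mem`, the record norms file `…NormsFlatGammaRec.norms136_dentedMember_flat_γ_d4` and
the record windows `windows136Z_of_small` BY NAME.  Kind «kernel-checked proof», theorems only: no `def`, no `… : Prop` fact, no `instance`, no `notation`, no existing module
modified.  `--supports stmt-QuantumFields-20541` (K0⁷-keyed, COUNT-NEUTRAL).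

HONEST SCOPE.  Bookkeeping; NO new estimate; the four-line flat socket `SB9`, the three REAL families and `H59D₁` remain displayed (discharged downstream as in the unitary record
chain); the record crown's Cov inputs are theorems (dag-n05-cov ✓p733782 ∕ ✓p734150); `HThm4Rec` UNDISCHARGED; N05 ∕ N07 NOT discharged; one finite `𝕋⁴` programme at fixed
`ε`, Bałaban AS PRINTED; nothing continuum ∕ ℝ⁴ ∕ OS ∕ mass-gap ∕ Clay.  No `sorry`, no `def`.
-/

noncomputable section

open NormedSpace
open Complex (I)

namespace Literature.MathematicalPhysics.QuantumFieldTheory.Balaban1983to89.B8Prop6DentedCubeMemberGaugedRealGammaGRec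

open MatrixLog B7Prop1Explicit B7Prop2Explicit B7Prop1Local B7AvgGaugeCovariance
open B7Eq92Concrete (mgauge mgauge_one_left)
open B7Prop2Explicit (c2' unitaryUnits)
open B7Prop2Rec (AvgClosedZ C0Z avgClosedZ_unitaryUnits)
open B7Prop3Flat (expCfg c3)
open B7Prop4GeneralLevelsRec (cZ gZ KZ gZ_nonneg)
open B7Prop5Flat (BondIn)
open BlockAveragingZd (avgIterZ ctrShift)
open B7SectCDGaugeAveragesRec (wrecZ)
open B7SectEFLinearisationRec (logCovIterZ)
open B8Ineq130Rec (tlo thi)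
open B8Ineq130 (gaugeAct_one)
open B8Ineq132 (InAk)
open B8Ineq133 (cutCfg_agree)
open B8Ineq133Rec (cutFixedZ avgIterZ_eq_of_agree)
open B8Eq115GaugeFixing (gaugeAct_mul gaugeAct_agree gaugeAct_mem_of)
open B8Eq115GaugeFixingRec (localGaugeZ towerGaugeZ)
open B8Eq119TwistedAxialRec (InAxZ Restr129Z UnderZ)
open B8Eq131DerivationRec (eq87_of_inAxZ_restr129Z)
open B8Eq146AExpansion (iEta)
open B8Eq184Proof (cfgExp)
open B8Eq140Level (SideTouches sideTouches_of_bondTouches)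
open B8Eq138LandauZd (logCfg covLap)
open B8Eq138LandauZdRec (IsLandau138WZ)
open B8Eq131Cubes (tLo tHi ctr)
open B8Eq131CubesRec (bLoZ bHiZ tLo_eq tHi_eq le_of_margin_mono)
open B8Lemma1NonAbelian (mulCfg)
open B8Prop6OfThm4 (const_136)
open B8LeafModelZd3 (mlogCfg mlogCfg_spec)
open B8Prop6CubeMemberEq137Rec (logCovIter_one_eq_mlog_avgIter_loc_of_window inBox_sq_top_of_bond mem_cubeZ_top_of_bondBox under_or_under_of_inBox_bondBoxZ)
open B8Prop6DentedCubeMemberGammaRec (thm4_hypotheses_one_cutFixed_dented_γ)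
open B8Prop6DentedCubeMemberGaugedRec (avgIter_cutFixed_eq_avgIter_axial logCovIter_eq_mlog_avgIter_dentedMember)
open B8DentedCubeMemberZdRec (lamST_top_apply)
open Node00 (CubeB8DZ GaugedBoundB8DZ)
open scoped Matrix
open MatrixLog B7Prop1Explicit B7Prop2Explicit B7Prop1Local B7Eq92Concrete
open B7Prop2Explicit (c2' c2'_pos)
open B7Prop2Rec (C0Z C0Z_pos)
open B7Prop3Flat (c3)
open B7SectEFLinearisationRec (linCovIterZ)
open B8Ineq132 (covDerivFwd InAk BondTouches)
open B8Ineq133Rec (cutFixedZ)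
open B8Eq115GaugeFixingRec (localGaugeZ)
open B8Eq119TwistedAxialRec (Restr129Z flmZ)
open B8Eq140Level (SideTouches)
open B8Eq143PlaqExpansion (pdiv)
open B8Eq146AExpansion (iEta plaqCovDeriv)
open B8Eq155JBound (Jcur wsup)
open B8ScaledSupNorm (bondNorm msup)
open B8Eq138LandauZd (covLap logCfg)
open B8LambdaSpaceKLevel (wt)
open B8Prop6OfThm4 (const_136 smallness_134)
open B8Prop6CubeMemberNorms (ineq161_of_small)
open B8Prop6DentedCubeMemberNormsGammaRec (prop3_windowsZ)
open B8Prop6DentedCubeMemberNormsFlatGammaRec (norms136_dentedMember_flat_γ_d4)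
open B8Prop6DentedCubeMemberFlatScalarGammaGRec (prop6_dentedMember_flat_of_real_γ_mem)
open B9SupplySockB9P3ZdBeta (CrossB)
open B8Real123FlatTranslateRec (Real123Block)
open B8Eq184Proof (gaugeExp)
open B7Prop1Explicit (expUnit)
open MatrixLog (mlog)
open B8Prop6DentedCubeMemberGaugedRealGammaRec (windows136Z_of_small)

export B7Prop1Explicit (Site)

variable {d : ℕ}

/-! ## §1 The clauses ⇒ `GaugedBoundB8DZ`'s body with `u ∈ G` -/

section Assembly

variable {𝔸 : Type*} [CStarAlgebra 𝔸] [Nontrivial 𝔸]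

/-- ★ (RECORD TWIN of `B8Prop6CubeMemberGaugedRealGammaG.gaugedBoundB8Body_of_clauses_mem`, at the DENTED record member.) **(1.135)–(1.138) ∕ (152)–(153) AT EVERY DENTED
RECORD CUBE FROM A `G`-VALUED GAUGE TRANSFORMATION WITH THEOREM 4's CLAUSES — the body of `Node00.GaugedBoundB8DZ` spelled out** (bookkeeping engine):
✓`B8Prop6DentedCubeMemberGaugedRec.gaugedBoundB8D_of_clauses` VERBATIM (datum regime, the record's Prop-4 window `4C₁KZ²α₂ ≤ 1`, `KZ·α₂ ≤ c₃`, (1.137)'s identity on the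
`Ω_k`-bonds of `□^{(k)}` by `logCovIter_eq_mlog_avgIter_dentedMember` at `A := mlogCfg …`, the (1.62) constant weakened by `const_136`) except that `u` and `w = v⁻¹u` are
`G`-valued for a subgroup `G ≤ U(𝔸)` and the conclusion is `GaugedBoundB8DZ`'s ∃-body with those two memberships at `G` (anonymous constructor; every carrier abbreviation
unfolds by `rfl`) — `Node00.GaugedBoundB8DZ` itself hard-wires `unitaryUnits`.  [Balaban1985Averaging] p. 20: «We consider a Lie subgroup G of a unitary group U(N)».
[cite: Balaban1985RegularSpaces, Prop. 6 (1.135)–(1.138) p.99, (1.137) p.99, (1.134) p.99, (1.62) p.87; Balaban1985Variational, (152)–(153) p.301; Balaban1985Averaging, p.20; Balaban1987RG1, (0.3)–(0.4) pp.252–253] -/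
theorem gaugedBoundB8DZBody_of_clauses_mem (hd2 : 2 ≤ d) {L s : ℕ} (hLs : L = 2 * s + 1) (hs : 1 ≤ s) {G : Subgroup 𝔸ˣ} (hGu : G ≤ unitaryUnits 𝔸)
    {B₀ : ℝ} (hB₀ : 0 < B₀) {η : ℝ} (hη : 0 < η) {K : ℕ}
    {Ω : ℕ → Set (Site d)} (c : CubeB8DZ d L K Ω) (U₀ : Site d → Fin d → 𝔸ˣ) (hU₀ : ∀ x κ, U₀ x κ ∈ unitaryUnits 𝔸) {α₀ : ℝ} (hα : 0 < α₀)
    (hA : InAk L c.k η α₀ Ω U₀) (hα3 : C0Z d * (α₀ * (L : ℝ) ^ 2) ≤ 1 / 3) (hα2 : 2 * (α₀ * (L : ℝ) ^ 2) ≤ c2' d L)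
    (hsmall : 11 * (d : ℝ) ^ 2 * (L : ℝ) ^ 2 * α₀ + ((c.M : ℝ) + 4 * c.ρ) * d * (L : ℝ) ^ 2 * α₀ ≤ 1 / 6)
    (h4C : 4 * (131072 * ((d : ℝ) + 1) ^ 2) * (KZ d L) ^ 2 * (5 * (d : ℝ) * L * B₀ * ((L : ℝ) ^ 3 * α₀ + 6 * d * (L : ℝ) ^ 2 * c.M * α₀)) ≤ 1)
    (hc3α : KZ d L * (5 * (d : ℝ) * L * B₀ * ((L : ℝ) ^ 3 * α₀ + 6 * d * (L : ℝ) ^ 2 * c.M * α₀)) ≤ c3 d L)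
    (u : Site d → 𝔸ˣ) (huG : ∀ x, u x ∈ G) (huS : ∀ x, x ∉ c.sq 0 → u x = 1)
    (h129 : Restr129Z L c.k c.lamS (1 : Site d → Fin d → 𝔸ˣ) u)
    (hLan : IsLandau138WZ L c.k η (c.sq 0) c.lamS (1 : Site d → Fin d → 𝔸ˣ)
      (gaugeAct u⁻¹ (cutFixedZ L (tLo c.a c.ρ) (tHi c.a c.M c.ρ) U₀ c.k (ctr c.a c.M))))
    (h162 : ∀ j, j ≤ c.k → ∀ b ∈ {b : Site d × Fin d | SideTouches (c.sq j) b.1 b.2},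
      gaugeAct u⁻¹ (cutFixedZ L (tLo c.a c.ρ) (tHi c.a c.M c.ρ) U₀ c.k (ctr c.a c.M)) b.1 b.2 =
          cfgExp η (logCfg η (gaugeAct u⁻¹ (cutFixedZ L (tLo c.a c.ρ) (tHi c.a c.M c.ρ) U₀ c.k (ctr c.a c.M)))) b.1 b.2 ∧
        IsSelfAdjoint (logCfg η (gaugeAct u⁻¹ (cutFixedZ L (tLo c.a c.ρ) (tHi c.a c.M c.ρ) U₀ c.k (ctr c.a c.M))) b.1 b.2) ∧
        ‖logCfg η (gaugeAct u⁻¹ (cutFixedZ L (tLo c.a c.ρ) (tHi c.a c.M c.ρ) U₀ c.k (ctr c.a c.M))) b.1 b.2‖ ≤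
          (5 * (d : ℝ) * L * B₀ * ((L : ℝ) ^ 3 * α₀ + 6 * d * (L : ℝ) ^ 2 * c.M * α₀)) * ((L : ℝ) ^ j * η)⁻¹)
    (hwG : ∀ x, ((localGaugeZ L (tLo c.a c.ρ) (tHi c.a c.M c.ρ) U₀ c.k (ctr c.a c.M))⁻¹ * u) x ∈ G)
    (h135 : AgreeOn (tlo L (tLo c.a c.ρ) c.k) (thi L (tHi c.a c.M c.ρ) c.k)
      (gaugeAct ((localGaugeZ L (tLo c.a c.ρ) (tHi c.a c.M c.ρ) U₀ c.k (ctr c.a c.M))⁻¹ * u)⁻¹ U₀)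
      (gaugeAct u⁻¹ (cutFixedZ L (tLo c.a c.ρ) (tHi c.a c.M c.ρ) U₀ c.k (ctr c.a c.M))))
    (h136₂ : B8ScaledSupNorm.msup L c.k η (-(2 : ℝ)) (fun j (t : Fin d × Fin d × Site d) => SideTouches (c.sq j) t.2.2 t.2.1)
      (fun t => B8Ineq132.covDerivFwd η (1 : Site d → Fin d → 𝔸ˣ) t.1
        (fun z => mlogCfg c.k η c.sq (gaugeAct u⁻¹ (cutFixedZ L (tLo c.a c.ρ) (tHi c.a c.M c.ρ) U₀ c.k (ctr c.a c.M))) z t.2.1)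
        t.2.2) ≤ 7 * d * (L : ℝ) ^ 2 * (5 * (d : ℝ) * L * B₀) * c.M * α₀)
    (h136₃ : B8ScaledSupNorm.bondNorm L c.k η (-(3 : ℝ)) c.sq
      (fun x μ => B8Eq143PlaqExpansion.pdiv η (1 : Site d → Fin d → 𝔸ˣ) (B8Eq146AExpansion.plaqCovDeriv η (1 : Site d → Fin d → 𝔸ˣ)
        (mlogCfg c.k η c.sq (gaugeAct u⁻¹ (cutFixedZ L (tLo c.a c.ρ) (tHi c.a c.M c.ρ) U₀ c.k (ctr c.a c.M))))) μ x)
        ≤ 7 * d * (L : ℝ) ^ 2 * (5 * (d : ℝ) * L * B₀) * c.M * α₀)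
    (h136₄ : B8ScaledSupNorm.bondNorm L c.k η (-(3 : ℝ)) c.sq
      (fun x μ => covLap η (1 : Site d → Fin d → 𝔸ˣ)
        (fun z => mlogCfg c.k η c.sq (gaugeAct u⁻¹ (cutFixedZ L (tLo c.a c.ρ) (tHi c.a c.M c.ρ) U₀ c.k (ctr c.a c.M))) z μ) x)
        ≤ 7 * d * (L : ℝ) ^ 2 * (5 * (d : ℝ) * L * B₀) * c.M * α₀) :
      ∃ u : Site d → 𝔸ˣ, (∀ x, u x ∈ G) ∧ (∀ x, x ∉ c.sq 0 → u x = 1) ∧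
        Restr129Z L c.k c.lamS (1 : Site d → Fin d → 𝔸ˣ) u ∧
        IsLandau138WZ L c.k η (c.sq 0) c.lamS (1 : Site d → Fin d → 𝔸ˣ) (c.fixed U₀ u) ∧
        (∀ j, j ≤ c.k → ∀ b ∈ {b : Site d × Fin d | SideTouches (c.sq j) b.1 b.2},
          c.fixed U₀ u b.1 b.2 = cfgExp η (logCfg η (c.fixed U₀ u)) b.1 b.2 ∧ IsSelfAdjoint (logCfg η (c.fixed U₀ u) b.1 b.2) ∧
            ‖logCfg η (c.fixed U₀ u) b.1 b.2‖ ≤ (7 * d * (L : ℝ) ^ 2 * (5 * (d : ℝ) * L * B₀) * c.M * α₀) * ((L : ℝ) ^ j * η)⁻¹) ∧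
        (∀ x, ((c.vfix U₀)⁻¹ * u) x ∈ G) ∧
        AgreeOn (tlo L (tLo c.a c.ρ) c.k) (thi L (tHi c.a c.M c.ρ) c.k) (gaugeAct ((c.vfix U₀)⁻¹ * u)⁻¹ U₀) (c.fixed U₀ u) ∧
        msup L c.k η (-(2 : ℝ)) (fun j (t : Fin d × Fin d × Site d) => SideTouches (c.sq j) t.2.2 t.2.1)
            (fun t => covDerivFwd η (1 : Site d → Fin d → 𝔸ˣ) t.1 (fun z => c.expo η U₀ u z t.2.1) t.2.2) ≤ (7 * d * (L : ℝ) ^ 2 * (5 * (d : ℝ) * L * B₀) * c.M * α₀) ∧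
        bondNorm L c.k η (-(3 : ℝ)) c.sq
            (fun x μ => pdiv η (1 : Site d → Fin d → 𝔸ˣ) (plaqCovDeriv η (1 : Site d → Fin d → 𝔸ˣ) (c.expo η U₀ u)) μ x) ≤ (7 * d * (L : ℝ) ^ 2 * (5 * (d : ℝ) * L * B₀) * c.M * α₀) ∧
        bondNorm L c.k η (-(3 : ℝ)) c.sq (fun x μ => covLap η (1 : Site d → Fin d → 𝔸ˣ) (fun z => c.expo η U₀ u z μ) x) ≤ (7 * d * (L : ℝ) ^ 2 * (5 * (d : ℝ) * L * B₀) * c.M * α₀) ∧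
        (∀ (x : Site d) (μ : Fin d), bLoZ L c.a 0 0 ≤ x → x + e μ ≤ bHiZ L c.a c.M 0 0 → c.inTop x → c.inTop (x + e μ) →
          logCovIterZ L (1 : Site d → Fin d → 𝔸ˣ) (iEta η (c.expo η U₀ u)) c.k x μ = mlog ((avgIterZ L (c.axial U₀) c.k x μ : 𝔸ˣ) : 𝔸)) := by
  have hu : ∀ x, u x ∈ unitaryUnits 𝔸 := fun x => hGu (huG x)
  have hL1 : 1 ≤ L := by omega
  have hd1 : 1 ≤ d := le_trans (by norm_num) hd2
  have hLpos : (0 : ℝ) < L := by exact_mod_cast hL1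
  have hdpos : (0 : ℝ) < d := by exact_mod_cast hd1
  have hρ : 1 ≤ c.ρ := hL1.trans c.L_le_ρ
  have hM1 : 1 ≤ c.M := hρ.trans c.ρ_le_M
  have hMpos : (0 : ℝ) < c.M := by exact_mod_cast hM1
  have hLdM : (L : ℝ) ≤ d * c.M := by exact_mod_cast c.L_le_dM
  have hB0 : 0 < 5 * (d : ℝ) * L * B₀ := by positivity
  set α₂ : ℝ := 5 * (d : ℝ) * L * B₀ * ((L : ℝ) ^ 3 * α₀ + 6 * d * (L : ℝ) ^ 2 * c.M * α₀) with hα₂_def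
  have hα₂0 : 0 ≤ α₂ := by positivity
  have h16 : 16 * α₂ ≤ 1 := by
    have hC1 : (1 : ℝ) ≤ 131072 * ((d : ℝ) + 1) ^ 2 := by nlinarith [sq_nonneg ((d : ℝ) + 1), hdpos]
    have hK2 : (2 : ℝ) ≤ KZ d L := by unfold KZ; have := gZ_nonneg d L; linarith
    have hK4 : (4 : ℝ) ≤ (KZ d L) ^ 2 := by nlinarith
    have h1 : (16 : ℝ) ≤ 4 * (131072 * ((d : ℝ) + 1) ^ 2) * (KZ d L) ^ 2 := by nlinarith
    have : 16 * α₂ ≤ 4 * (131072 * ((d : ℝ) + 1) ^ 2) * (KZ d L) ^ 2 * α₂ := mul_le_mul_of_nonneg_right h1 hα₂0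
    exact this.trans h4C
  set U'' := cutFixedZ L (tLo c.a c.ρ) (tHi c.a c.M c.ρ) U₀ c.k (ctr c.a c.M) with hU''
  obtain ⟨hmem, -, -, -, -, -⟩ := thm4_hypotheses_one_cutFixed_dented_γ hLs hs hd1 c U₀ hU₀ hα hα3 hα2 hη hA hsmall
  have hU₁u : ∀ x κ, gaugeAct u⁻¹ U'' x κ ∈ unitaryUnits 𝔸 := gaugeAct_mem_of hmem fun x => (unitaryUnits 𝔸).inv_mem (hu x)
  obtain ⟨-, hrep, -⟩ := mlogCfg_spec hη hL1 c.k (1 : Site d → Fin d → 𝔸ˣ) hU₁u hα₂0 h16 c.sq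
    (fun j hj y τ hsd => ⟨(h162 j hj (y, τ) hsd).1, (h162 j hj (y, τ) hsd).2.2⟩)
  have h162k : ∀ (z : Site d) (ν : Fin d), SideTouches (c.sq c.k) z ν →
      gaugeAct u⁻¹ U'' z ν = cfgExp η (mlogCfg c.k η c.sq (gaugeAct u⁻¹ U'')) z ν ∧
        ‖mlogCfg c.k η c.sq (gaugeAct u⁻¹ U'') z ν‖ ≤ α₂ * ((L : ℝ) ^ c.k * η)⁻¹ := fun z ν hsd =>
    ⟨(hrep c.k le_rfl z ν hsd).2, by rw [(hrep c.k le_rfl z ν hsd).1]; exact (h162 c.k le_rfl (z, ν) hsd).2.2⟩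
  have h137 : ∀ (x : Site d) (μ : Fin d), bLoZ L c.a 0 0 ≤ x → x + e μ ≤ bHiZ L c.a c.M 0 0 → c.inTop x → c.inTop (x + e μ) →
      logCovIterZ L (1 : Site d → Fin d → 𝔸ˣ)
          (iEta η (mlogCfg c.k η c.sq (gaugeAct u⁻¹ U''))) c.k x μ =
        mlog ((avgIterZ L (gaugeAct (localGaugeZ L (tLo c.a c.ρ) (tHi c.a c.M c.ρ) U₀ c.k (ctr c.a c.M)) U₀) c.k x μ : 𝔸ˣ) : 𝔸) := by
    intro x μ hx hx' hix hix'
    rw [← avgIter_cutFixed_eq_avgIter_axial hLs c.k U₀ c.a c.ρ x μ hx hx']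
    exact logCovIter_eq_mlog_avgIter_dentedMember hd2 hLs hs c U₀ hU₀ hα hα3 hα2 hη hA hsmall u h129 _ hα₂0 h4C hc3α h162k x μ hx hx' hix hix'
  have h162' : ∀ j, j ≤ c.k → ∀ b ∈ {b : Site d × Fin d | SideTouches (c.sq j) b.1 b.2},
      gaugeAct u⁻¹ U'' b.1 b.2 = cfgExp η (logCfg η (gaugeAct u⁻¹ U'')) b.1 b.2 ∧ IsSelfAdjoint (logCfg η (gaugeAct u⁻¹ U'') b.1 b.2) ∧
        ‖logCfg η (gaugeAct u⁻¹ U'') b.1 b.2‖ ≤ (7 * d * (L : ℝ) ^ 2 * (5 * (d : ℝ) * L * B₀) * c.M * α₀) * ((L : ℝ) ^ j * η)⁻¹ := by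
    intro j hj b hb
    obtain ⟨h1, h2, h3⟩ := h162 j hj b hb
    refine ⟨h1, h2, h3.trans ?_⟩
    have hη0 : 0 ≤ ((L : ℝ) ^ j * η)⁻¹ := by positivity
    exact mul_le_mul_of_nonneg_right (const_136 hLpos hα hB0.le hLdM) hη0
  exact ⟨u, huG, huS, h129, hLan, h162', hwG, h135, h136₂, h136₃, h136₄, h137⟩

end Assembly

/-! ## §2 The body at every dented record cube from the flat γ inputs, `G`-valued fields and gauge transformations -/

section Real

variable {𝔸 : Type} [CStarAlgebra 𝔸] [Nontrivial 𝔸]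

open Classical in
/-- ★★ (RECORD TWIN of `B8Prop6CubeMemberGaugedRealGammaG.gaugedBoundB8_cubeMember_real_γ_mem`, at the DENTED record member.) **PROPOSITION 6 (p. 99), (1.135)–(1.138) ∕ [15]
(152)–(153) AT EVERY DENTED RECORD CUBE WITH A `G`-VALUED GAUGE TRANSFORMATION, FROM THE FLAT FOUR-LINE PROP.-3-FRAME γ SOCKET, THREE REAL INEQUALITY FAMILIES AND
THEOREM 4's (1.59) CLAUSE AT BACKGROUND `1`** ([Balaban1985Averaging] p. 20 «a Lie subgroup G of a unitary group U(N)»).  ✓`B8Prop6DentedCubeMemberGaugedRealGammaRec.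
gaugedBoundB8D_dentedMember_real_γ` VERBATIM except: the joint J-SU data `(τ) (hτ) {G H} (hGrp2) (hGrp3) (hGA : AvgClosedZ d L G) (hGH) (hGu) (hexpG)` are parameters, `U₀` is
`G`-valued, and the CONCLUSION is `Node00.GaugedBoundB8DZ L η U₀ c (7dL²·5dLB₀·Mα₀)`'s BODY SPELLED OUT for the witness `u` with the two membership conjuncts at `G` (`u ∈ G`,
`v⁻¹u ∈ G`).  Served by (G4) `B8Prop6DentedCubeMemberFlatScalarGammaGRec.prop6_dentedMember_flat_of_real_γ_mem` and, unchanged, by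
`B8Prop6DentedCubeMemberNormsFlatGammaRec.norms136_dentedMember_flat_γ_d4` (which takes `u` as an input); assembled by `gaugedBoundB8DZBody_of_clauses_mem`.
[cite: Balaban1985RegularSpaces, Prop. 6 (1.135)–(1.138) p.99, Thm 4 p.88, Prop. 3 p.87, Prop. 5 pp.93–94, (1.58)–(1.59) p.86, (1.31) p.82; Balaban1985Variational, (148)–(153) p.301; Balaban1985Averaging, p.20; Balaban1985BackgroundPropagators, Thms 3.1–3.3 pp.397–399; Balaban1987RG1, (0.3)–(0.4) pp.252–253] -/
theorem gaugedBoundB8D_dentedMember_real_γ_mem (τ : 𝔸 →L[ℂ] ℂ) (hτ : ∀ x y : 𝔸, τ (x * y) = τ (y * x)) (hd2 : 2 ≤ d) {L sL : ℕ} (hLs : L = 2 * sL + 1)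
    (hs1 : 1 ≤ sL)
    {G H : Subgroup 𝔸ˣ} (hGrp2 : ∀ g ∈ H, ‖(g : 𝔸) - 1‖ ≤ 1 / 8 → τ (mlog (g : 𝔸)) = 0) (hGrp3 : ∀ S : 𝔸, τ S = 0 → expUnit S ∈ H)
    (hGA : AvgClosedZ d L G) (hGH : G ≤ H) (hGu : G ≤ unitaryUnits 𝔸)
    (hexpG : ∀ lam : Site d → 𝔸, (∀ x, IsSelfAdjoint (lam x)) → (∀ x, τ (lam x) = 0) → ∀ x, gaugeExp lam x ∈ G)
    {B₀ B₀' C₂ cB9 B₀'H B₂' BG BR Bbd : ℝ} (hB₀ : 0 < B₀)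
    (hB₀' : 0 < B₀') (hB : 2 ≤ 5 * (d : ℝ) * L * B₀) (hC₂ : 2 * ((1 + 2 * gZ d L) * (2 * (131072 * ((d : ℝ) + 1) ^ 2) * (KZ d L) ^ 2)) * (L : ℝ) ^ 2 ≤ C₂) (hcB9 : 0 < cB9)
    (hB₀'H : 0 < B₀'H) (hB₂' : 0 ≤ B₂') (hBG : 0 ≤ BG) (hBR : 0 ≤ BR) (hfree : 3 * (2 * (d : ℝ) * (L : ℝ) ^ 2) * BG * BR ≤ B₀')
    (hBbd : 0 ≤ Bbd) (hBd : 4 * Bbd ≤ ((d : ℝ) * L - 1) * B₀) :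
    ∃ c₁ : ℝ, 0 < c₁ ∧ ∀ (η : ℝ), 0 < η → ∀ {K : ℕ} {Ω : ℕ → Set (Site d)} (c : CubeB8DZ d L K Ω),
      -- (1.59) for `G(1)`, `H(1)` IN THE REPAIRED CURRENCY: the FOUR-LINE Prop.-3-frame socket at background `1` on the cube, collar term on each line
      (∀ α₀' α₂ : ℝ, 0 < α₀' → α₀' ≤ cB9 → 0 < α₂ → α₂ ≤ cB9 →
        ∀ (W : Site d → Fin d → 𝔸ˣ), (∀ x κ, W x κ ∈ unitaryUnits 𝔸) →
        InAk L c.k η α₀' c.sq (1 : Site d → Fin d → 𝔸ˣ) → InAk L c.k η α₀' c.sq (mulCfg W (1 : Site d → Fin d → 𝔸ˣ)) →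
        IsLandau138WZ L c.k η (c.sq 0) c.lamS (1 : Site d → Fin d → 𝔸ˣ) W →
        ∀ A' : Site d → Fin d → 𝔸, (∀ y τ, IsSelfAdjoint (A' y τ)) →
        (∀ j, j ≤ c.k → ∀ (y : Site d) (τ : Fin d), SideTouches (c.sq j) y τ →
          W y τ = cfgExp η A' y τ ∧ ‖A' y τ‖ ≤ α₂ * ((L : ℝ) ^ j * η)⁻¹) →
        (∀ (y : Site d) (τ : Fin d), (∀ j, j ≤ c.k → ¬ SideTouches (c.sq j) y τ) → A' y τ = 0) →
        msup L c.k η (-(1 : ℝ)) (fun j (b : Site d × Fin d) => SideTouches (c.sq j) b.1 b.2) (fun b => A' b.1 b.2)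
            ≤ B₀ * (bondNorm L c.k η (-(3 : ℝ)) c.sq (fun x μ => Jcur η (1 : Site d → Fin d → 𝔸ˣ) A' μ x)
              + wsup 1 (fun p : {p : ℕ × (Site d × Fin d) // p.1 ≤ c.k ∧ (p.2 ∈ c.lamBPT c.k p.1 ∨ (p.1 = 0 ∧ CrossB (c.sq 0) p.2))} =>
                  linCovIterZ L (1 : Site d → Fin d → 𝔸ˣ) (iEta η A') p.1.1 p.1.2.1 p.1.2.2))
              + Bbd * msup L c.k η (-(1 : ℝ)) (fun j (b : Site d × Fin d) => j = 0 ∧ SideTouches (c.sq 0) b.1 b.2 ∧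
                  ¬ BondTouches (c.sq 0) b.1 b.2) (fun b => A' b.1 b.2) ∧
          msup L c.k η (-(2 : ℝ)) (fun j (t : Fin d × Fin d × Site d) => SideTouches (c.sq j) t.2.2 t.2.1)
              (fun t => covDerivFwd η (1 : Site d → Fin d → 𝔸ˣ) t.1 (fun z => A' z t.2.1) t.2.2)
            ≤ B₀ * (bondNorm L c.k η (-(3 : ℝ)) c.sq (fun x μ => Jcur η (1 : Site d → Fin d → 𝔸ˣ) A' μ x)
              + wsup 1 (fun p : {p : ℕ × (Site d × Fin d) // p.1 ≤ c.k ∧ (p.2 ∈ c.lamBPT c.k p.1 ∨ (p.1 = 0 ∧ CrossB (c.sq 0) p.2))} =>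
                  linCovIterZ L (1 : Site d → Fin d → 𝔸ˣ) (iEta η A') p.1.1 p.1.2.1 p.1.2.2))
              + Bbd * msup L c.k η (-(1 : ℝ)) (fun j (b : Site d × Fin d) => j = 0 ∧ SideTouches (c.sq 0) b.1 b.2 ∧
                  ¬ BondTouches (c.sq 0) b.1 b.2) (fun b => A' b.1 b.2) ∧
          bondNorm L c.k η (-(3 : ℝ)) c.sq (fun x μ => pdiv η (1 : Site d → Fin d → 𝔸ˣ) (plaqCovDeriv η (1 : Site d → Fin d → 𝔸ˣ) A') μ x)
            ≤ B₀ * (bondNorm L c.k η (-(3 : ℝ)) c.sq (fun x μ => Jcur η (1 : Site d → Fin d → 𝔸ˣ) A' μ x)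
              + wsup 1 (fun p : {p : ℕ × (Site d × Fin d) // p.1 ≤ c.k ∧ (p.2 ∈ c.lamBPT c.k p.1 ∨ (p.1 = 0 ∧ CrossB (c.sq 0) p.2))} =>
                  linCovIterZ L (1 : Site d → Fin d → 𝔸ˣ) (iEta η A') p.1.1 p.1.2.1 p.1.2.2))
              + Bbd * msup L c.k η (-(1 : ℝ)) (fun j (b : Site d × Fin d) => j = 0 ∧ SideTouches (c.sq 0) b.1 b.2 ∧
                  ¬ BondTouches (c.sq 0) b.1 b.2) (fun b => A' b.1 b.2) ∧
          bondNorm L c.k η (-(3 : ℝ)) c.sq (fun x μ => covLap η (1 : Site d → Fin d → 𝔸ˣ) (fun z => A' z μ) x)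
            ≤ B₀ * (bondNorm L c.k η (-(3 : ℝ)) c.sq (fun x μ => Jcur η (1 : Site d → Fin d → 𝔸ˣ) A' μ x)
              + wsup 1 (fun p : {p : ℕ × (Site d × Fin d) // p.1 ≤ c.k ∧ (p.2 ∈ c.lamBPT c.k p.1 ∨ (p.1 = 0 ∧ CrossB (c.sq 0) p.2))} =>
                  linCovIterZ L (1 : Site d → Fin d → 𝔸ˣ) (iEta η A') p.1.1 p.1.2.1 p.1.2.2))
              + Bbd * msup L c.k η (-(1 : ℝ)) (fun j (b : Site d × Fin d) => j = 0 ∧ SideTouches (c.sq 0) b.1 b.2 ∧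
                  ¬ BondTouches (c.sq 0) b.1 b.2) (fun b => A' b.1 b.2)) →
      ∀ (U₀ : Site d → Fin d → 𝔸ˣ), (∀ x κ, U₀ x κ ∈ G) → ∀ (α₀ : ℝ), 0 < α₀ → InAk L K η α₀ Ω U₀ →
      7 * d * (L : ℝ) ^ 2 * c.M * α₀ ≤ c₁ →
      -- the weights of `Q′ᵀwQ′` and THE THREE REAL INEQUALITY FAMILIES at every truncation `n ≤ k`, CENTRED labels (`Real123Block`)
      ∀ (w : ℕ → ℝ), (∀ j, 0 ≤ w j) →
      (∀ n, 1 ≤ n → n ≤ c.k → Real123Block L (flmZ L) η n w c.sq (c.lamST n) BG B₀'H B₂' BR) →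
      -- (1.59) for `G(1)` IN THE REPAIRED CURRENCY: Theorem 4's two-member clause at background `1`, support clause + collar allowance (`H59D₁`)
      ((∀ m, 1 ≤ m → m ≤ c.k → ∀ (u : Site d → 𝔸ˣ) (W : Site d → Fin d → 𝔸ˣ) (A' : Site d → Fin d → 𝔸),
        (∀ x, u x ∈ unitaryUnits 𝔸) → (∀ x, x ∉ c.sq 0 → u x = 1) →
          mgauge (1 : Site d → Fin d → 𝔸ˣ) u W = (cutFixedZ L (tLo c.a c.ρ) (tHi c.a c.M c.ρ) U₀ c.k (ctr c.a c.M)) →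
          Restr129Z L m (c.lamST m) (1 : Site d → Fin d → 𝔸ˣ) u →
          IsLandau138WZ L m η (c.sq 0) (c.lamST m) (1 : Site d → Fin d → 𝔸ˣ) W →
        (∀ y τ, IsSelfAdjoint (A' y τ)) →
        (∀ j, j ≤ m → ∀ y τ, SideTouches (c.sq j) y τ →
        W y τ = cfgExp η A' y τ ∧
          ‖A' y τ‖ ≤ (2 * (L * (5 * (d : ℝ) * L * B₀ * (((L : ℝ) ^ 3 * α₀) + (6 * d * (L : ℝ) ^ 2 * c.M * α₀)))) + 8 * (8 * B₀' * (5 * (d : ℝ) * L * B₀) * (((L : ℝ) ^ 3 * α₀) + (6 * d * (L : ℝ) ^ 2 * c.M * α₀)))) * ((L : ℝ) ^ j * η)⁻¹) →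
        (∀ y τ, (∀ j, j ≤ m → ¬ SideTouches (c.sq j) y τ) → A' y τ = 0) →
        msup L m η (-(1 : ℝ)) (fun j (b : Site d × Fin d) => SideTouches (c.sq j) b.1 b.2) (fun b => A' b.1 b.2)
        ≤ B₀ * (bondNorm L m η (-(3 : ℝ)) c.sq (fun x μ => Jcur η (1 : Site d → Fin d → 𝔸ˣ) A' μ x)
        + wsup 1 (fun p : {p : ℕ × (Site d × Fin d) // p.1 ≤ m ∧ (p.2 ∈ c.lamBPT m p.1 ∨ (p.1 = 0 ∧ CrossB (c.sq 0) p.2))} =>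
        linCovIterZ L (1 : Site d → Fin d → 𝔸ˣ) (iEta η A') p.1.1 p.1.2.1 p.1.2.2))
        + Bbd * msup L m η (-(1 : ℝ)) (fun j (b : Site d × Fin d) => j = 0 ∧ SideTouches (c.sq 0) b.1 b.2 ∧
            ¬ BondTouches (c.sq 0) b.1 b.2) (fun b => A' b.1 b.2) ∧
        msup L m η (-(2 : ℝ)) (fun j (t : Fin d × Fin d × Site d) => SideTouches (c.sq j) t.2.2 t.2.1)
        (fun t => covDerivFwd η (1 : Site d → Fin d → 𝔸ˣ) t.1 (fun z => A' z t.2.1) t.2.2)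
        ≤ B₀ * (bondNorm L m η (-(3 : ℝ)) c.sq (fun x μ => Jcur η (1 : Site d → Fin d → 𝔸ˣ) A' μ x)
        + wsup 1 (fun p : {p : ℕ × (Site d × Fin d) // p.1 ≤ m ∧ (p.2 ∈ c.lamBPT m p.1 ∨ (p.1 = 0 ∧ CrossB (c.sq 0) p.2))} =>
        linCovIterZ L (1 : Site d → Fin d → 𝔸ˣ) (iEta η A') p.1.1 p.1.2.1 p.1.2.2))
        + Bbd * msup L m η (-(1 : ℝ)) (fun j (b : Site d × Fin d) => j = 0 ∧ SideTouches (c.sq 0) b.1 b.2 ∧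
            ¬ BondTouches (c.sq 0) b.1 b.2) (fun b => A' b.1 b.2))) →
      ∃ u : Site d → 𝔸ˣ, (∀ x, u x ∈ G) ∧ (∀ x, x ∉ c.sq 0 → u x = 1) ∧
        Restr129Z L c.k c.lamS (1 : Site d → Fin d → 𝔸ˣ) u ∧
        IsLandau138WZ L c.k η (c.sq 0) c.lamS (1 : Site d → Fin d → 𝔸ˣ) (c.fixed U₀ u) ∧
        (∀ j, j ≤ c.k → ∀ b ∈ {b : Site d × Fin d | SideTouches (c.sq j) b.1 b.2},
          c.fixed U₀ u b.1 b.2 = cfgExp η (logCfg η (c.fixed U₀ u)) b.1 b.2 ∧ IsSelfAdjoint (logCfg η (c.fixed U₀ u) b.1 b.2) ∧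
            ‖logCfg η (c.fixed U₀ u) b.1 b.2‖ ≤ (7 * d * (L : ℝ) ^ 2 * (5 * (d : ℝ) * L * B₀) * c.M * α₀) * ((L : ℝ) ^ j * η)⁻¹) ∧
        (∀ x, ((c.vfix U₀)⁻¹ * u) x ∈ G) ∧
        AgreeOn (tlo L (tLo c.a c.ρ) c.k) (thi L (tHi c.a c.M c.ρ) c.k) (gaugeAct ((c.vfix U₀)⁻¹ * u)⁻¹ U₀) (c.fixed U₀ u) ∧
        msup L c.k η (-(2 : ℝ)) (fun j (t : Fin d × Fin d × Site d) => SideTouches (c.sq j) t.2.2 t.2.1)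
            (fun t => covDerivFwd η (1 : Site d → Fin d → 𝔸ˣ) t.1 (fun z => c.expo η U₀ u z t.2.1) t.2.2) ≤ (7 * d * (L : ℝ) ^ 2 * (5 * (d : ℝ) * L * B₀) * c.M * α₀) ∧
        bondNorm L c.k η (-(3 : ℝ)) c.sq
            (fun x μ => pdiv η (1 : Site d → Fin d → 𝔸ˣ) (plaqCovDeriv η (1 : Site d → Fin d → 𝔸ˣ) (c.expo η U₀ u)) μ x) ≤ (7 * d * (L : ℝ) ^ 2 * (5 * (d : ℝ) * L * B₀) * c.M * α₀) ∧
        bondNorm L c.k η (-(3 : ℝ)) c.sq (fun x μ => covLap η (1 : Site d → Fin d → 𝔸ˣ) (fun z => c.expo η U₀ u z μ) x) ≤ (7 * d * (L : ℝ) ^ 2 * (5 * (d : ℝ) * L * B₀) * c.M * α₀) ∧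
        (∀ (x : Site d) (μ : Fin d), bLoZ L c.a 0 0 ≤ x → x + e μ ≤ bHiZ L c.a c.M 0 0 → c.inTop x → c.inTop (x + e μ) →
          logCovIterZ L (1 : Site d → Fin d → 𝔸ˣ) (iEta η (c.expo η U₀ u)) c.k x μ = mlog ((avgIterZ L (c.axial U₀) c.k x μ : 𝔸ˣ) : 𝔸)) := by
  have hL1 : 1 ≤ L := by omega
  have hL : 2 ≤ L := by omega
  have hd1 : 1 ≤ d := le_trans (by norm_num) hd2
  have hLpos : (0 : ℝ) < L := by exact_mod_cast hL1
  have hdpos : (0 : ℝ) < d := by exact_mod_cast hd1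
  have hgZ := gZ_nonneg d L
  have hC₂0 : 0 ≤ C₂ := le_trans (by positivity) hC₂
  obtain ⟨c₄, hc₄, H4⟩ := prop6_dentedMember_flat_of_real_γ_mem (𝔸 := 𝔸) τ hτ hd2 hLs hs1 hGrp2 hGrp3 hGA hGH hGu hexpG hB₀ hB₀' hB hB₀'H hB₂' hBG hBR
    hfree hBbd hBd
  obtain ⟨c₃, hc₃, N3⟩ := norms136_dentedMember_flat_γ_d4 (𝔸 := 𝔸) hd2 hLs hs1 hB₀ hC₂ hcB9 hBbd hBd
  obtain ⟨cW, hcW, W⟩ := windows136Z_of_small hd2 hL hB₀ hC₂0 hc₃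
  set B : ℝ := 5 * (d : ℝ) * L * B₀ with hB_def
  have hB0 : 0 < B := by positivity
  have hKZ2 : (2 : ℝ) ≤ KZ d L := by have h := gZ_nonneg d L; show (2 : ℝ) ≤ 2 * (1 + 2 * gZ d L); linarith only [h]
  have hKZ0 : 0 < KZ d L := by linarith only [hKZ2]
  set C : ℝ := 131072 * ((d : ℝ) + 1) ^ 2 * (KZ d L) ^ 2 with hC_def
  have hC0 : 0 < C := by positivity
  refine ⟨min c₄ (min cW (1 / (16 * C * B))), lt_min hc₄ (lt_min hcW (by positivity)), ?_⟩
  intro η hη K Ω c SB9 U₀ hU₀G α₀ hα hAK hs w hw REAL H59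
  have hU₀ : ∀ x κ, U₀ x κ ∈ unitaryUnits 𝔸 := fun x κ => hGu (hU₀G x κ)
  -- the cube's laws as datum binders
  have hk : 1 ≤ c.k := c.one_le_k
  have hρL : L ≤ c.ρ := c.L_le_ρ
  have hρM : c.ρ ≤ c.M := c.ρ_le_M
  have hρ : 1 ≤ c.ρ := hL1.trans hρL
  have hM1 : 1 ≤ c.M := hρ.trans hρM
  have hM : 11 * (d : ℝ) < c.M := by exact_mod_cast c.big
  have hLdM : (L : ℝ) ≤ d * c.M := by exact_mod_cast c.L_le_dM
  have hA : InAk L c.k η α₀ Ω U₀ := c.inAk hAK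
  have hs₄ : 7 * d * (L : ℝ) ^ 2 * c.M * α₀ ≤ c₄ := hs.trans (min_le_left _ _)
  have hsW : 7 * d * (L : ℝ) ^ 2 * c.M * α₀ ≤ cW := hs.trans ((min_le_right _ _).trans (min_le_left _ _))
  have hsC : 7 * d * (L : ℝ) ^ 2 * c.M * α₀ ≤ 1 / (16 * C * B) := hs.trans ((min_le_right _ _).trans (min_le_right _ _))
  -- every window from «7dL²Mα₀ ≤ c₁»
  obtain ⟨⟨hα3, hα2, hsmall⟩, ⟨hα₀c, hα₁c, hα₂c⟩, h61, ⟨-, -, h16, -, hc3α, hsmall₁⟩, h12⟩ := W c.M c.ρ hM1 hρM hM hLdM α₀ hα hsW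
  -- PROPOSITION 6's existence half at the member FROM THE REAL FAMILIES + `H59D₁` (this seat's `B8Prop6CubeMemberFlatScalarBdry`)
  obtain ⟨u, huG, huS, h129, hLan, h162, hw', h135⟩ := H4 η hη c U₀ hU₀G α₀ hα hα3 hα2 hA
    hsmall (smallness_134 hLpos hα hLdM hs₄) w hw REAL H59
  have hu : ∀ x, u x ∈ unitaryUnits 𝔸 := fun x => hGu (huG x)
  -- PROPOSITION 3's norm members at the member FROM THE FOUR-LINE FLAT SOCKET (this seat's `B8Prop6CubeMemberNormsFlatBdry4`)
  obtain ⟨h136g, h139j, h139l⟩ := N3 η hη c SB9 U₀ hU₀ α₀ hα hα3 hα2 hA hsmall hα₀c hα₂c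
    h61 hsmall₁ u hu huS h129 hLan h162
  -- the three norm members of (1.136), with print's constant (`const_136`)
  have hconst : B * ((L : ℝ) ^ 3 * α₀ + 6 * d * (L : ℝ) ^ 2 * c.M * α₀) ≤ 7 * d * (L : ℝ) ^ 2 * B * c.M * α₀ :=
    const_136 hLpos hα hB0.le hLdM
  have h136₂ := h136g.trans hconst
  have h136₃ := h139j.trans hconst
  have h136₄ := h139l.trans hconst
  have h16C : 16 * (131072 * ((d : ℝ) + 1) ^ 2 * (KZ d L) ^ 2) * (B * ((L : ℝ) ^ 3 * α₀ + 6 * d * (L : ℝ) ^ 2 * c.M * α₀)) ≤ 1 := by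
    have e1 : B * ((L : ℝ) ^ 3 * α₀ + 6 * d * (L : ℝ) ^ 2 * c.M * α₀) ≤ 7 * d * (L : ℝ) ^ 2 * B * c.M * α₀ := hconst
    have e3 : B * (7 * d * (L : ℝ) ^ 2 * c.M * α₀) ≤ B * (1 / (16 * C * B)) := mul_le_mul_of_nonneg_left hsC hB0.le
    have e4 : B * (1 / (16 * C * B)) = 1 / (16 * C) := by field_simp
    have e2 : 7 * d * (L : ℝ) ^ 2 * B * c.M * α₀ = B * (7 * d * (L : ℝ) ^ 2 * c.M * α₀) := by ring
    have e5 : B * ((L : ℝ) ^ 3 * α₀ + 6 * d * (L : ℝ) ^ 2 * c.M * α₀) ≤ 1 / (16 * C) := by linarith [e1, e3]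
    calc 16 * (131072 * ((d : ℝ) + 1) ^ 2 * (KZ d L) ^ 2) * (B * ((L : ℝ) ^ 3 * α₀ + 6 * d * (L : ℝ) ^ 2 * c.M * α₀))
        ≤ 16 * C * (1 / (16 * C)) := mul_le_mul_of_nonneg_left e5 (by positivity)
      _ = 1 := by field_simp
  have h4C : 4 * (131072 * ((d : ℝ) + 1) ^ 2) * (KZ d L) ^ 2 * (5 * (d : ℝ) * L * B₀ * ((L : ℝ) ^ 3 * α₀ + 6 * d * (L : ℝ) ^ 2 * c.M * α₀)) ≤ 1 := by
    have h0 : 0 ≤ (131072 * ((d : ℝ) + 1) ^ 2 * (KZ d L) ^ 2) * (B * ((L : ℝ) ^ 3 * α₀ + 6 * d * (L : ℝ) ^ 2 * c.M * α₀)) := by positivity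
    have e : 4 * (131072 * ((d : ℝ) + 1) ^ 2) * (KZ d L) ^ 2 * (5 * (d : ℝ) * L * B₀ * ((L : ℝ) ^ 3 * α₀ + 6 * d * (L : ℝ) ^ 2 * c.M * α₀))
        = 4 * ((131072 * ((d : ℝ) + 1) ^ 2 * (KZ d L) ^ 2) * (B * ((L : ℝ) ^ 3 * α₀ + 6 * d * (L : ℝ) ^ 2 * c.M * α₀))) := by rw [hB_def]; ring
    rw [e]; linarith only [h16C, h0]
  exact gaugedBoundB8DZBody_of_clauses_mem hd2 hLs hs1 hGu hB₀ hη c U₀ hU₀ hα hA hα3 hα2 hsmall h4C hc3α u huG huS h129 hLan h162 hw' h135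
    h136₂ h136₃ h136₄

end Real

#print axioms gaugedBoundB8DZBody_of_clauses_mem
#print axioms gaugedBoundB8D_dentedMember_real_γ_mem

end Literature.MathematicalPhysics.QuantumFieldTheory.Balaban1983to89.B8Prop6DentedCubeMemberGaugedRealGammaGRec

end
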